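import Summits.ResolutionOfSingularities.ResolutionOfSingularities.Theorems.MarkedTransferCampaignW31EdgeHilbDictionary
import Summits.ResolutionOfSingularities.ResolutionOfSingularities.Theorems.MarkedTransferCampaignW31UscFiniteDegree
import Literature.AlgebraicGeometry.Hironaka2017.S04CharAlgebra.R004eIdealReadings
import HarnessLib

/-!
# [OURS · L1 W3.1] THE SLOT STATEMENT «u.s.c. of `ξ ↦ Inv_ξ(E)` for ONE ideal exponent» MODULO THE SINGLE TYPED CANDIDATE
# `U19_4_R2` (Hasse–Schmidt stability of the edge algebra, §4.1 (8) p.19, reading R2) — and why reading R1 (`U19_4`) is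
# degenerate (seat res-L1-s31-pv-3)

Cell `res-hironaka` (run/shared/lean/pub/res-hironaka/), rung L (rescue) of LADDER-RESOLUTION, slot W3.1 «u.s.c. first»
(positive rung, verdict-free). HOST (custody, no new route): the existing crux `Theses.MarkedTransfer.HypersurfaceOrderReduction`
stmt-ResolutionOfSingularities-16155, `--supports … --as helper`, as every W3.1 file. Composes kernel theorems of the slot:
(i) `CampaignW31EdgeHilbLsc_holds` (res-L1-s31-pv-2, p474858, unconditional); the edge-piece bridge and the structure argument
(res-L1-s31-pv-3, p477733/p478382); the finite-degree assembly `campaignW31UscInvOneExponentI_of_dictionary`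
(res-L1-s31-pv-1, p475766: input (iii) is not needed); k31's assembly p467881; res-type-005's standard-base lemmas p472731.

HONEST FRAMING. OURS-side algebra / pure logic over OUR typed statements; NOTHING here is a statement of H. Hironaka's
manuscript *Resolution of singularities in positive characteristics* (2017-03-23, [Hironaka2017], lit key
`paper:url-3343fd9e678b`). The ONE premise left is a typed candidate CONSUMED AS A HYPOTHESIS for every perfect ambient datum,
never asserted: `S04CharAlgebra.U19_4_R2 p f E` (R004eIdealReadings, reading R2 of §4.1 (8) p.19 l.31–32 «so that `G` must
be Diff-closed»: row 004's set `edgeG (℘(E)_ξ) z ⊆ κ(ξ)[Z]` is stable under every HASSE–SCHMIDT DERIVATION `∂^{(β)}` of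
`κ(ξ)[Z]`). The gate records these theorems as conditional on it. No FACT-LIST fact is consumed. AI-produced; weaker than
expert review.

## Why reading R2 and not R1 (`U19_4`)

p478382 proved piece (ii) modulo reading R1 `U19_4` («stable under EVERY `κ(ξ)`-linear differential operator of `κ(ξ)[Z]` of
every order»). That reading is DEGENERATE: order-`0` operators are the multiplications (tree `Resolution.isDiffOpLE_mulLeft`)
and `1 ∈ edgeG`, so `U19_4` forces `edgeG (℘(E)_ξ) z = κ(ξ)[Z]` at every closed singular point
(`CampaignW31.edgeG_eq_univ_of_forall_diffOp` below) — which fails as soon as `℘(E,1)_ξ ≠ 𝔪_ξ`, e.g. whenever `Sing(E)` is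
positive-dimensional at `ξ` (lane-Lib `pAlg_ideal_le_singIdeal`). The typers' reading R2 (`U19_4_R2`, Hasse–Schmidt
derivations only — exactly the tree's `Resolution.IsDiffStable`) is what the structure theorem needs and what this file
consumes; reading R1 implies R2 (`U19_4_R2_of_U19_4`), so p478382's theorems are the special case.

## What is proved (sorry-free; axioms ⊆ {propext, Classical.choice, Quot.sound})

* `CampaignW31.edgeG_eq_univ_of_forall_diffOp` — degeneracy of reading R1 at a point (pure algebra, any local ring).
* `U19_4_R2_of_U19_4` — R1 ⇒ R2 (`∂^{(β)} ∈ Diff^{≤|β|}`, tree `hasseDeriv_mem_diffOp`).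
* **`campaignW31EdgeHilbDictionary_of_U19_4_R2`** : `(∀ K A E, U19_4_R2 p A.hom E) → CampaignW31EdgeHilbDictionary p` — piece
  (ii) modulo R2 (same route as p478382: `A.Z` regular and locally Noetherian; `U` graded (p477733) and Hasse–Schmidt stable
  (R2); `κ(ξ)` perfect (`U20_3_holds`); `edgeHilbAt = hilbFun U = N(q(D); ·)` by `hilbFun_eq_hilb_of_isMinHomogGens`).
* **`campaignW31UscInvOneExponentI_of_U19_4_R2`** : `(∀ K A E, U19_4_R2 p A.hom E) → CampaignW31UscInvOneExponentI p` — THE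
  SLOT STATEMENT of RESCUE-SEED §1 W3.1 modulo reading R2 ONLY (via res-L1-s31-pv-1's `campaignW31UscInvOneExponentI_of_dictionary`);
  with the hypersurface rung `campaignW31UscInvHypersurfaceI_of_U19_4_R2`, the p.30 consequences
  `campaignW31InvmaxClosedI_of_U19_4_R2`, the superlevel form `campaignW31UscInvOneExponentCJSI_of_U19_4_R2`, and the
  parametric `campaignW31UscInvOneExponent_of_U19_4_R2` (all primes, at row 005 part b's provenance).

## What remains for an unconditional W3.1

The discharge of `U19_4_R2` (§4.1 (8) p.19 l.30–32): from the stalkwise Diff-closedness of `℘(E)_ξ` (`U19_3`; D-lane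
`U19_3_of` from `Thm4_1`, file U19L29) to Hasse–Schmidt stability of `G ⊆ κ(ξ)[Z]` — the symbol calculus of the Hasse–Schmidt
derivations of `O_ξ` with respect to a regular system of parameters (they exist on the smooth `O_ξ` over the perfect `K`,
have order `|β|`, and induce `∂^{(β)}` on `gr_𝔪 O_ξ = κ(ξ)[Z]`).

## References (context only; nothing below is a premise)

* H. Hironaka, ms. 2017-03-23, §4.1 (8) p.19 l.27–32; Eq. (34) p.24; p.30 l.4–8; p.86 l.7–10 — scope only, under
  adjudication. [Hironaka2017]
* H. Kawanoue, Publ. RIMS 43 (2007), Def. 3.1.1.1 (𝔇-saturation), Lemma 3.1.2.1. [Kawanoue2007]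
-/

noncomputable section

set_option linter.dupNamespace false -- mandated namespace of this single-conjunct summit

open scoped Polynomial
open IsLocalRing

namespace Summit.ResolutionOfSingularities.ResolutionOfSingularities.Theorems

open _root_.AlgebraicGeometry
open Literature.AlgebraicGeometry.Resolution
open Literature.AlgebraicGeometry.Hironaka2017
open Literature.AlgebraicGeometry.Hironaka2017.S02Preliminaries
open Literature.AlgebraicGeometry.Hironaka2017.S04CharAlgebra

universe u

namespace CampaignW31

/-! ## Reading R1 is degenerate; R1 ⇒ R2 -/

section Readings

variable {O : Type u} [CommRing O] [IsLocalRing O] {n : ℕ}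
  (z : Fin n → O) (hz : Ideal.span (Set.range z) = maximalIdeal O)

/-- `1 ∈ edgeG P z`: the pulled-back edge algebra contains the constants. [folklore] -/
theorem one_mem_edgeG (P : Subalgebra O O[X]) : (1 : MvPolynomial (Fin n) (ResidueField O)) ∈ edgeG P z hz := by
  show polyMap z hz 1 ∈ (edgeAlgebra P : Set (FibreCone (maximalIdeal O)))
  rw [map_one]
  exact Subalgebra.one_mem _

/-- **Degeneracy of reading R1 at a point**: if `edgeG P z ⊆ κ[Z]` is stable under every `κ`-linear differential operator
of `κ[Z]` of order `≤ 0` (already), it is all of `κ[Z]` — order-`0` operators are the multiplications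
(tree `Resolution.isDiffOpLE_mulLeft`) and `1 ∈ edgeG`. [folklore] -/
theorem edgeG_eq_univ_of_forall_diffOp (P : Subalgebra O O[X])
    (hD : ∀ (Dbar : MvPolynomial (Fin n) (ResidueField O) →ₗ[ResidueField O] MvPolynomial (Fin n) (ResidueField O)),
      Dbar ∈ diffOp (ResidueField O) (MvPolynomial (Fin n) (ResidueField O)) 0 →
        ∀ F ∈ edgeG P z hz, Dbar F ∈ edgeG P z hz) :
    edgeG P z hz = Set.univ := by
  refine Set.eq_univ_of_forall fun f => ?_
  have h := hD (LinearMap.mulLeft (ResidueField O) f) (isDiffOpLE_mulLeft f) 1 (one_mem_edgeG z hz P)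
  rwa [LinearMap.mulLeft_apply, mul_one] at h

end Readings

end CampaignW31

open CampaignW31

section Sheaf

variable {K : Type u} [Field K] {Z : Scheme.{u}}

/-- **Reading R1 of §4.1 (8) forces the edge algebra to be everything**: under `U19_4 p f E` (every differential operator),
at every closed `ξ ∈ Sing(E)` and every regular system of parameters `z`, `edgeG (℘(E)_ξ) z = κ(ξ)[Z_1,…,Z_n]` — the typed
reading R1 is degenerate (a reading for the G7 lead / lanes, not a verdict). NOT a statement of the manuscript. [folklore] -/
theorem edgeG_eq_univ_of_U19_4 (p : ℕ) [Fact p.Prime] [CharP K p] (f : Z ⟶ Spec (.of K)) (E : IdealExponent Z)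
    (h : U19_4 p f E) (hA : IsAmbient p f) (hK : PerfectField K) (hE : E.IsStandard) {ξ : Z} (hξ : ξ ∈ E.sing)
    (hcl : ξ ∈ S02Preliminaries.closedPoints Z) {n : ℕ} (z : Fin n → Z.presheaf.stalk ξ)
    (hz : IsRSP (Z.presheaf.stalk ξ) z) : edgeG (pStalk E ξ) z hz.2.1 = Set.univ :=
  edgeG_eq_univ_of_forall_diffOp z hz.2.1 (pStalk E ξ) fun Dbar hDbar F hF => h hA hK hE ξ hξ hcl n z hz 0 Dbar hDbar F hF

/-- Reading R1 (`U19_4`, every differential operator) implies reading R2 (`U19_4_R2`, Hasse–Schmidt derivations), since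
`∂^{(β)} ∈ Diff^{≤|β|}` (tree `hasseDeriv_mem_diffOp`). [folklore] -/
theorem U19_4_R2_of_U19_4 (p : ℕ) [Fact p.Prime] [CharP K p] (f : Z ⟶ Spec (.of K)) (E : IdealExponent Z)
    (h : U19_4 p f E) : U19_4_R2 p f E := by
  classical
  intro hA hK hE ξ hξ hcl n z hz β F hF
  exact h hA hK hE ξ hξ hcl n z hz β.degree _ (hasseDeriv_mem_diffOp _ β) F hF

end Sheaf

/-! ## Piece (ii) and the slot statement modulo reading R2 -/

/-- **[OURS · L1 W3.1] piece (ii) `CampaignW31EdgeHilbDictionary p` modulo reading R2 `U19_4_R2`** (Hasse–Schmidt stability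
of `edgeG (℘(E)_ξ) z`, §4.1 (8) p.19 — HYPOTHESIS for every perfect ambient datum, not asserted): `dim_{κ(ξ)} G(ξ)_a =
N(q(D); a)` for every Def. 4.9 edge datum at a closed singular point of a standard `E`. Same kernel route as p478382 with the
sound reading. NOT a statement of the manuscript. [folklore] -/
theorem campaignW31EdgeHilbDictionary_of_U19_4_R2 (p : ℕ) [Fact p.Prime]
    (hG : ∀ (K : Type u) [Field K] [CharP K p] [PerfectField K] (A : AmbientDatum p K) (E : IdealExponent A.Z),
      U19_4_R2 p A.hom E) :
    CampaignW31EdgeHilbDictionary.{u} p := by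
  intro K _ _ _ A n E hE ξ hξ D hD a
  obtain ⟨z, hz, gbar, hhom, hmin, -, -⟩ := hD
  haveI := A.smooth
  haveI : IsLocallyNoetherian A.Z := LocallyOfFiniteType.isLocallyNoetherian A.hom
  have hR : Scheme.IsRegular A.Z := Scheme.IsRegular.of_smooth A.hom (Scheme.isRegular_Spec (.of K))
  have hA : IsAmbient p A.hom := ⟨(Fact.out : p.Prime).pos, A.irreducible, A.smooth, A.quasiCompact⟩
  obtain ⟨U, hU⟩ := exists_subalgebra_coe_eq_edgeG z hz.2.1 (pStalk E ξ)
  have hUg : IsGradedSubalgebra U := isGradedSubalgebra_edgeG hR E ξ hz.2.1 hU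
  have hUd : IsDiffStable U := by
    intro F hF β
    have hF' : F ∈ edgeG (pStalk E ξ) z hz.2.1 := by rw [← hU]; exact hF
    rw [← SetLike.mem_coe, hU]
    exact hG K A E hA inferInstance hE ξ hξ.1 hξ.2 n z hz β F hF'
  letI := stalkAlgebra (kStructure A.hom) ξ
  haveI : PerfectField (ResidueField (A.Z.presheaf.stalk ξ)) :=
    (U20_3_holds p A.hom E hA inferInstance hE ξ hξ.1 hξ.2).2.2.1
  haveI : CharP (ResidueField (A.Z.presheaf.stalk ξ)) p :=
    charP_of_injective_algebraMap (algebraMap K (ResidueField (A.Z.presheaf.stalk ξ))).injective p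
  haveI : ExpChar (ResidueField (A.Z.presheaf.stalk ξ)) p := ExpChar.prime Fact.out
  haveI : PerfectRing (ResidueField (A.Z.presheaf.stalk ξ)) p := PerfectField.toPerfectRing p
  rw [edgeHilbAt_eq_hilbFun hR E ξ hz hU a]
  exact_mod_cast hilbFun_eq_hilb_of_isMinHomogGens (p := p) z hz.2.1 (pStalk E ξ) hU hUg hUd hmin hhom
    (CampaignW31.monotone_q D) a

/-- **[OURS · L1 W3.1] THE SLOT STATEMENT MODULO READING R2 ONLY** (replaces the role of p.86 l.7–10 / p.30 l.4–8 for ONE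
ideal exponent; NOT a statement of the manuscript): if, for every perfect ambient datum, `edgeG (℘(E)_ξ) z` is stable under the
Hasse–Schmidt derivations of `κ(ξ)[Z]` (typed candidate `U19_4_R2`, HYPOTHESIS), then for every perfect `K` of characteristic
`p`, ambient datum `A`, `n`, standard `E` and selection of Def. 4.9 edge data, `ξ ↦ Inv_ξ(E)` is upper semicontinuous on
`Sing(E)_cl`. [folklore] -/
theorem campaignW31UscInvOneExponentI_of_U19_4_R2 (p : ℕ) [Fact p.Prime]
    (hG : ∀ (K : Type u) [Field K] [CharP K p] [PerfectField K] (A : AmbientDatum p K) (E : IdealExponent A.Z),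
      U19_4_R2 p A.hom E) : CampaignW31UscInvOneExponentI.{u} p :=
  campaignW31UscInvOneExponentI_of_dictionary p (campaignW31EdgeHilbDictionary_of_U19_4_R2 p hG)

/-- **[OURS · L1 W3.1] the hypersurface rung modulo reading R2** (`CampaignW31UscInvHypersurfaceI p`: `J` effective Cartier,
the setting of the host crux stmt-16155 and of K3.1's specimen). NOT a statement of the manuscript. [folklore] -/
theorem campaignW31UscInvHypersurfaceI_of_U19_4_R2 (p : ℕ) [Fact p.Prime]
    (hG : ∀ (K : Type u) [Field K] [CharP K p] [PerfectField K] (A : AmbientDatum p K) (E : IdealExponent A.Z),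
      U19_4_R2 p A.hom E) : CampaignW31UscInvHypersurfaceI.{u} p :=
  campaignW31UscInvHypersurfaceI_of_dictionary p (campaignW31EdgeHilbDictionary_of_U19_4_R2 p hG)

/-- **[OURS · L1 W3.1] `Inv_max` attained and the `Inv_max`-stratum closed (the presuppositions of Eq. (43) p.30), modulo
reading R2.** NOT a statement of the manuscript. [folklore] -/
theorem campaignW31InvmaxClosedI_of_U19_4_R2 (p : ℕ) [Fact p.Prime]
    (hG : ∀ (K : Type u) [Field K] [CharP K p] [PerfectField K] (A : AmbientDatum p K) (E : IdealExponent A.Z),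
      U19_4_R2 p A.hom E) : CampaignW31InvmaxClosedI.{u} p :=
  campaignW31InvmaxClosedI_of_dictionary p (campaignW31EdgeHilbDictionary_of_U19_4_R2 p hG)

/-- **[OURS · L1 W3.1] the superlevel-set (Cossart–Jannsen–Saito) form of the slot statement, modulo reading R2**
(p467881 `campaignW31UscInvOneExponentI_iff_CJSI`). NOT a statement of the manuscript. [folklore] -/
theorem campaignW31UscInvOneExponentCJSI_of_U19_4_R2 (p : ℕ) [Fact p.Prime]
    (hG : ∀ (K : Type u) [Field K] [CharP K p] [PerfectField K] (A : AmbientDatum p K) (E : IdealExponent A.Z),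
      U19_4_R2 p A.hom E) : CampaignW31UscInvOneExponentCJSI.{u} p :=
  (campaignW31UscInvOneExponentI_iff_CJSI p).1 (campaignW31UscInvOneExponentI_of_U19_4_R2 p hG)

/-- **[OURS · L1 W3.1] parametric form**: reading R2 at every prime gives `CampaignW31UscInvOneExponent` AT row 005 part b's
provenance `CampaignW31.edgeDataProvenance` (p463247 `campaignW31UscInvOneExponentI_iff`). NOT a statement of the manuscript.
[folklore] -/
theorem campaignW31UscInvOneExponent_of_U19_4_R2
    (hG : ∀ (p : ℕ) [Fact p.Prime] (K : Type u) [Field K] [CharP K p] [PerfectField K] (A : AmbientDatum p K)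
      (E : IdealExponent A.Z), U19_4_R2 p A.hom E) :
    CampaignW31UscInvOneExponent.{u} CampaignW31.edgeDataProvenance :=
  campaignW31UscInvOneExponentI_iff.mpr fun p _ => campaignW31UscInvOneExponentI_of_U19_4_R2 p (hG p)

end Summit.ResolutionOfSingularities.ResolutionOfSingularities.Theorems

end
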